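import Literature.MathematicalPhysics.QuantumFieldTheory.Balaban1983to89.B9Eq349FlatDGQKernel
import Literature.MathematicalPhysics.QuantumFieldTheory.Balaban1983to89.B5QGGQ145Factor

/-!
# `Balaban1983to89.B9Eq349FlatQGKernel` — T. Bałaban, *Propagators for lattice gauge theories in a background field*, Commun. Math. Phys. **99** (1985)
# 389–434 [Balaban1985BackgroundPropagators] (3.25) p. 394 at `U ≡ 1` (the factor `Q′G′`), with [Balaban1984PropagatorsI] (1.44) p. 25 and
# [Balaban1983RegularityDecay] Lemma 2.4 (2.35) p. 582: **THE FLAT KERNEL OF THE CHAIN's `Q̃′G′(1)` IS THE TRANSPOSE OF b04's `K_T` — `(Q̃′G′(1)f)(y) =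
# Σ_x ((c₀∕c₁)ρ·K_T(x̂, ŷ))•f(x)` — BY THE ADJOINT READING (`G′(1)` is self-adjoint, `Q̃′G′ = (G′Q̃′†)†`), AND IT DECAYS IN `tdist` AT b04's STRIP RATE** — route R2′
# STEP B8′ of the pub-balaban NE9 chain, road B8″ S1 (the flat dictionary), SECOND of its three kernels (`B = Q̃′G′`)

statement-level skeleton of published theorems with citation tags; proofs where landed; nothing here is a claim about the Yang–Mills mass gap

CITATION HEADER (lean-in-tree rule).  Audit cell `pub-balaban`, sub-cell `t4`, BINDER row NE9; filed by NE9 formalisation-swarm LEAF PROVER 06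
(`b2b-balaban-t4-ne9-formalise-leaf-06`, gen 68), sequel of `B9Eq349FlatDGQKernel` (same seat; road B8″ of `t4/ROUTES-NE9.md` v13.37 ADDENDUM (ii), t4-ne9-idea-1
gen 100).  b05's matrix model writes the same factor as `B5QGGQ145Factor.QGRe := ξ^{d+1}·KReᵀ` («the adjoint of `G′Q′^*` for the pairings `Σ_y` on `T₁` and
`ξ^{d+1}Σ_z` on `T_ξ` (`G′` symmetric, `K_T` real)»); this file proves that reading for the chain's OPERATOR `Q̃′ ∘ G′(1)` on the weighted carriers
(`SiteL2K ℂ (d+1) (L·m) c₀ W → SiteL2K ℂ (d+1) m c₁ W`), where the weight ratio is `c₀∕c₁` (`= ξ^{d+1} = L^{−(d+1)}` at the canonical weights).  Sources READ: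
[Balaban1985BackgroundPropagators] pp. 394–395 in the held text (`paper:balaban1985-cmp99-background-propagators`); [B5′] p. 25, [B4] p. 582 through the cell's
audited headers (`B5QGGQ145Factor`, `B4Torus248Decay`).

THE PRINT (verbatim).  [B9] p. 394 (3.25): *«Rf = (I − G′Q′*(Q′G′²Q′*)⁻¹Q′G′)f»*; p. 395: *«R(U) is an orthogonal projection»* (so `G′`, `Δ′_a` are self-adjoint
in `L²(Ω₀, g)`); [B5′] p. 25 (1.44): *«R = I − G′_kQ′_k^*(Q′_kG′_k²Q′_k^*)^{−1}Q′_kG′_k»*.  Nothing of print's estimates is asserted.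

WHAT IS PROVED (sorry-free; proof lane — no `def`; [folklore] adjoint bookkeeping; dimension `d+1` as J-M-α ∕ b04).
* §1 **`inner_greenK_left_eq_right`** (abstract, `RCLike 𝕜`): for a SYMMETRIC `T` with positive definite real part, its Green operator
  `B11Eq103H1Complex.greenK T` is symmetric: `⟪T⁻¹x, y⟫ = ⟪x, T⁻¹y⟫`; **`inner_GpOfU_one_comm`**: the chain's `G′(1) = GpOfU … 1 …` is symmetric on `SiteL2K`
  (`B9Eq325ProjFormula.laplacePrimeA_isSymmetric` at the flat `hRS` `adTransportW_adjoint_one`).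
* §2 **`equiv_QGp_one_apply`** — THE KERNEL OF `Q̃′G′(1)`: for `η ≠ 0`, `a′ > 0`, ANY positivity witness `hpos′`, every fine `f` and coarse `y`:
  `(Q̃′(G′(1)f))(y) = Σ_{x ∈ T_{L·m}} (((c₀∕c₁)·ρ : ℂ)·conj K_T(L,a,0,m; x̂, ŷ))•f(x)` (`ρ`, `a` as in `B9Eq349FlatDGQKernel`; `Q̃′` read into the weight-`c₁` carrier
  exactly as in `B9Eq325ProjFormula.RofU_eq_formula_one`) — tested against every coarse `ψ`: `⟪ψ, Q̃′G′f⟫ = ⟪G′Q̃′†ψ, f⟫` (§1) and `B9Eq349FlatDGQKernel.equiv_GpQadj_one_apply`;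
  **`equiv_QGp_one_apply_real`**: the same with `conj K_T = K_T` (`B5QGGQ145Bounds.conj_KT`: the flat kernel is real).
* §3 **`norm_flatB_le`** — THE DECAY: from b04's bound at `(L, a, 0, m)`, `‖((c₀∕c₁)ρ)·conj K_T(x̂, ŷ)‖ ≤ (c₀∕c₁)ρ·MC·e^{−κ′·d_m(y, blk x)}` — the `hB` shape of
  `B9Eq349KernelConvolutionDecay.block_decay_of_conv3_kernel` (`tdist_symm`); the VOLUME-free package is `B9Eq349FlatDGQKernel.exists_flatA_bound` BY NAME.
HONEST SCOPE.  Dictionary + decay transfer for the SECOND of the three flat kernels of `T(1)`; the middle kernel `(Q̃′G′(1)²Q̃′†)⁻¹` and the assembly are NOT here;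
flat background ONLY; the rate is b04's crude `∃ κ`.  NOT NE9 (cell pub-balaban: NE9 NOT PRINTED ∕ NOT PROVED; «NE9 ⇐ the named binders»; row WALLED ON A MODEL
(O-NE9-1; #5 UNRULED); spine PROVED 0∕9; rung (B)+1 on a finite T⁴ — NOT infinite volume, NOT mass gap, NOT Clay; HONEST DEPENDENCY: continuum YM on T⁴ ⇐ BetaPertH ∧
nine spine estimates (0/9 proved); BetaPertH ⇐ (D1) ∧ (D4) ∧ CAP+tail; G-an2-4 gates asym, D1 and NE2/3/4).  NEW file importing `B9Eq349FlatDGQKernel` (this seat) and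
b05's `B5QGGQ145Factor` (⊇ `B5QGGQ145Bounds.conj_KT`); nothing modified.  Net new unproved facts: 0.
-/

noncomputable section

set_option autoImplicit false

open scoped BigOperators InnerProductSpace ComplexConjugate

namespace Literature.MathematicalPhysics.QuantumFieldTheory.Balaban1983to89.B9Eq349FlatQGKernel

open B4Sect5Torus (TSite tdist tdist_symm)
open B9SectCLatticeCarrier (Bond)
open B9Eq311L2Pairing (WL2)
open B9Eq319QprimeTorus (fineP blockCoord)
open B11Eq103H1Complex (SiteL2K greenK apply_greenK)
open B9Eq326OperatorAssembly (QprimeW)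
open B9Eq3119DeltaPiCarrier (laplacePrimeA GpOfU)
open B9Eq325ProjFormula (laplacePrimeA_isSymmetric adTransportW_adjoint_one)
open B9Eq315QTorusOnto (liftSite)
open B4Torus248Decay (torusKernel248)
open B4TorusKernel.MultiPeriod (torusSupNorm)
open B4TorusGreen244 (KT)
open B5QGGQ145Bounds (conj_KT)
open B9Eq365QGGQFlatCarrierDictionary (one_le_period)
open B9Eq349FlatDGQKernel (equiv_GpQadj_one_apply norm_KT_liftSite_le)

variable {d : ℕ}

/-! ## §1 The Green operator of a symmetric positive operator is symmetric; `G′(1)` -/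

section Symm

variable {𝕜 : Type*} [RCLike 𝕜] {E : Type*} [NormedAddCommGroup E] [InnerProductSpace 𝕜 E] [FiniteDimensional 𝕜 E]

/-- **`T` symmetric ⟹ `T⁻¹` symmetric**: `⟪T⁻¹x, y⟫ = ⟪T⁻¹x, T(T⁻¹y)⟫ = ⟪T(T⁻¹x), T⁻¹y⟫ = ⟪x, T⁻¹y⟫`. [folklore]
[cite: Balaban1985BackgroundPropagators, p.395 («orthogonal projection»), Thm 3.11 p.416] -/
theorem inner_greenK_left_eq_right {T : E →ₗ[𝕜] E} (hT : T.IsSymmetric) (hpos : ∀ x : E, x ≠ 0 → 0 < RCLike.re ⟪x, T x⟫_𝕜) (x y : E) :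
    ⟪greenK T hpos x, y⟫_𝕜 = ⟪x, greenK T hpos y⟫_𝕜 := by
  conv_lhs => rw [← apply_greenK hpos y]
  rw [← hT, apply_greenK]

end Symm

section Chain

variable (L : ℕ) [NeZero L] (m : Fin (d + 1) → ℕ) [∀ i, NeZero (m i)] [∀ i, NeZero (fineP L m i)]
  {𝔸 : Type*} [Ring 𝔸] [Algebra ℂ 𝔸] {W : Type*} [NormedAddCommGroup W] [InnerProductSpace ℂ W] [FiniteDimensional ℂ W]
  (φ : W ≃ₗ[ℂ] 𝔸) (c₀ : ℝ) [Fact (0 < c₀)] (η : ℝ) (c₁ : ℝ) [Fact (0 < c₁)]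

omit [∀ i, NeZero (m i)] [∀ i, NeZero (fineP L m i)] in
/-- **`G′(1)` IS SYMMETRIC on the chain's `L²(sites)`** (`Δ′_{a′}(1)` symmetric at the flat `hRS`). [cite: Balaban1985BackgroundPropagators, (3.24)–(3.25) p.394, p.395] -/
theorem inner_GpOfU_one_comm (a' : ℝ)
    (hpos' : ∀ x : SiteL2K ℂ (d + 1) (fineP L m) c₀ W, x ≠ 0 →
      0 < RCLike.re ⟪x, laplacePrimeA L m φ η (fun _ : Bond (d + 1) (fineP L m) => (1 : 𝔸ˣ)) a' (c₁ := c₁) x⟫_ℂ)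
    (u f : SiteL2K ℂ (d + 1) (fineP L m) c₀ W) :
    ⟪GpOfU L m φ η (fun _ : Bond (d + 1) (fineP L m) => (1 : 𝔸ˣ)) a' (c₁ := c₁) hpos' u, f⟫_ℂ =
      ⟪u, GpOfU L m φ η (fun _ : Bond (d + 1) (fineP L m) => (1 : 𝔸ˣ)) a' (c₁ := c₁) hpos' f⟫_ℂ :=
  inner_greenK_left_eq_right (laplacePrimeA_isSymmetric L m φ c₀ η _ c₁ a' (adTransportW_adjoint_one L m φ)) hpos' u f

/-! ## §2 The kernel of the flat `Q̃′G′(1)` (the adjoint reading) -/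

/-- **THE KERNEL OF `Q̃′G′(1)`**: `(Q̃′(G′(1)f))(y) = Σ_x (((c₀∕c₁)ρ : ℂ)·conj K_T(L,a,0,m; x̂, ŷ))•f(x)`, `ρ = (ηL)²c₁∕(c₀L^{d+1})`, `a = a′ρ`.
[cite: Balaban1985BackgroundPropagators, (3.25) p.394; Balaban1984PropagatorsI, (1.44) p.25; Balaban1983RegularityDecay, (2.48) p.585] -/
theorem equiv_QGp_one_apply (hη : η ≠ 0) {a' : ℝ} (ha' : 0 < a')
    (hpos' : ∀ x : SiteL2K ℂ (d + 1) (fineP L m) c₀ W, x ≠ 0 →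
      0 < RCLike.re ⟪x, laplacePrimeA L m φ η (fun _ : Bond (d + 1) (fineP L m) => (1 : 𝔸ˣ)) a' (c₁ := c₁) x⟫_ℂ)
    (f : SiteL2K ℂ (d + 1) (fineP L m) c₀ W) (y : TSite (d + 1) m) :
    WL2.equiv ℂ _ W (((WL2.linearEquiv ℂ ℂ (fun _ : TSite (d + 1) m => c₁)).symm.toLinearMap ∘ₗ
        QprimeW L m φ (fun _ : Bond (d + 1) (fineP L m) => (1 : 𝔸ˣ)) (c₀ := c₀))
        (GpOfU L m φ η (fun _ : Bond (d + 1) (fineP L m) => (1 : 𝔸ˣ)) a' (c₁ := c₁) hpos' f)) y =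
      ∑ x : TSite (d + 1) (fineP L m), ((((c₀ / c₁ * ((η * L) ^ 2 * (c₁ / (c₀ * (L : ℝ) ^ (d + 1))))) : ℝ) : ℂ) *
        conj (KT L (a' * (η * L) ^ 2 * (c₁ / (c₀ * (L : ℝ) ^ (d + 1)))) 0 m (liftSite x) (liftSite y))) • WL2.equiv ℂ _ W f x := by
  have hc₀ : 0 < c₀ := Fact.out
  have hc₁ : 0 < c₁ := Fact.out
  have hcast : ∀ r : ℝ, (RCLike.ofReal r : ℂ) = (r : ℂ) := fun _ => rfl
  -- the candidate with the transposed kernel (a local `set`, no definition)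
  set g' : SiteL2K ℂ (d + 1) m c₁ W := (WL2.equiv ℂ (fun _ : TSite (d + 1) m => c₁) W).symm
    (fun y => ∑ x : TSite (d + 1) (fineP L m), ((((c₀ / c₁ * ((η * L) ^ 2 * (c₁ / (c₀ * (L : ℝ) ^ (d + 1))))) : ℝ) : ℂ) *
        conj (KT L (a' * (η * L) ^ 2 * (c₁ / (c₀ * (L : ℝ) ^ (d + 1)))) 0 m (liftSite x) (liftSite y))) • WL2.equiv ℂ _ W f x) with hg'
  suffices h : ((WL2.linearEquiv ℂ ℂ (fun _ : TSite (d + 1) m => c₁)).symm.toLinearMap ∘ₗ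
      QprimeW L m φ (fun _ : Bond (d + 1) (fineP L m) => (1 : 𝔸ˣ)) (c₀ := c₀))
      (GpOfU L m φ η (fun _ : Bond (d + 1) (fineP L m) => (1 : 𝔸ˣ)) a' (c₁ := c₁) hpos' f) = g' by
    rw [h, hg', Equiv.apply_symm_apply]
  apply ext_inner_left ℂ
  intro ψ
  -- left: `⟪ψ, Q̃′G′f⟫ = ⟪Q̃′†ψ, G′f⟫ = ⟪G′Q̃′†ψ, f⟫ = Σ_x c₀ ⟪(G′Q̃′†ψ)(x), f(x)⟫`
  rw [← LinearMap.adjoint_inner_left, ← inner_GpOfU_one_comm L m φ c₀ η c₁ a' hpos', WL2.inner_def, WL2.inner_def]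
  simp only [hcast]
  -- expand the fine values of `G′Q̃′†ψ` by the `A`-file's kernel and the coarse values of `g'` by its definition
  have hl : ∀ x : TSite (d + 1) (fineP L m),
      ((c₀ : ℝ) : ℂ) * ⟪WL2.equiv ℂ _ W (GpOfU L m φ η (fun _ : Bond (d + 1) (fineP L m) => (1 : 𝔸ˣ)) a' (c₁ := c₁) hpos'
          (LinearMap.adjoint ((WL2.linearEquiv ℂ ℂ (fun _ : TSite (d + 1) m => c₁)).symm.toLinearMap ∘ₗ
            QprimeW L m φ (fun _ : Bond (d + 1) (fineP L m) => (1 : 𝔸ˣ)) (c₀ := c₀)) ψ)) x, WL2.equiv ℂ _ W f x⟫_ℂ =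
        ∑ y' : TSite (d + 1) m, ((c₀ : ℝ) : ℂ) *
          (conj (((((η * L) ^ 2 * (c₁ / (c₀ * (L : ℝ) ^ (d + 1)))) : ℝ) : ℂ) *
              KT L (a' * (η * L) ^ 2 * (c₁ / (c₀ * (L : ℝ) ^ (d + 1)))) 0 m (liftSite x) (liftSite y')) *
            ⟪WL2.equiv ℂ _ W ψ y', WL2.equiv ℂ _ W f x⟫_ℂ) := by
    intro x
    rw [equiv_GpQadj_one_apply L m φ c₀ η c₁ hη ha' hpos' ψ x, sum_inner, Finset.mul_sum]
    refine Finset.sum_congr rfl fun y' _ => ?_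
    rw [inner_smul_left]
  have hr : ∀ y' : TSite (d + 1) m,
      ((c₁ : ℝ) : ℂ) * ⟪WL2.equiv ℂ _ W ψ y', WL2.equiv ℂ _ W g' y'⟫_ℂ =
        ∑ x : TSite (d + 1) (fineP L m), ((c₀ : ℝ) : ℂ) *
          (conj (((((η * L) ^ 2 * (c₁ / (c₀ * (L : ℝ) ^ (d + 1)))) : ℝ) : ℂ) *
              KT L (a' * (η * L) ^ 2 * (c₁ / (c₀ * (L : ℝ) ^ (d + 1)))) 0 m (liftSite x) (liftSite y')) *
            ⟪WL2.equiv ℂ _ W ψ y', WL2.equiv ℂ _ W f x⟫_ℂ) := by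
    intro y'
    rw [hg', Equiv.apply_symm_apply, inner_sum, Finset.mul_sum]
    refine Finset.sum_congr rfl fun x _ => ?_
    rw [inner_smul_right, map_mul, Complex.conj_ofReal]
    have hc₁' : ((c₁ : ℝ) : ℂ) ≠ 0 := by exact_mod_cast hc₁.ne'
    have e : ((c₁ : ℝ) : ℂ) * (((c₀ / c₁ * ((η * L) ^ 2 * (c₁ / (c₀ * (L : ℝ) ^ (d + 1))))) : ℝ) : ℂ) =
        ((c₀ : ℝ) : ℂ) * ((((η * L) ^ 2 * (c₁ / (c₀ * (L : ℝ) ^ (d + 1)))) : ℝ) : ℂ) := by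
      push_cast
      field_simp
    calc ((c₁ : ℝ) : ℂ) * ((((c₀ / c₁ * ((η * L) ^ 2 * (c₁ / (c₀ * (L : ℝ) ^ (d + 1))))) : ℝ) : ℂ) *
            conj (KT L (a' * (η * L) ^ 2 * (c₁ / (c₀ * (L : ℝ) ^ (d + 1)))) 0 m (liftSite x) (liftSite y')) *
          ⟪WL2.equiv ℂ _ W ψ y', WL2.equiv ℂ _ W f x⟫_ℂ)
        = (((c₁ : ℝ) : ℂ) * (((c₀ / c₁ * ((η * L) ^ 2 * (c₁ / (c₀ * (L : ℝ) ^ (d + 1))))) : ℝ) : ℂ)) *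
            (conj (KT L (a' * (η * L) ^ 2 * (c₁ / (c₀ * (L : ℝ) ^ (d + 1)))) 0 m (liftSite x) (liftSite y')) *
              ⟪WL2.equiv ℂ _ W ψ y', WL2.equiv ℂ _ W f x⟫_ℂ) := by ring
      _ = _ := by rw [e]; ring
  simp only [hl, hr]
  exact Finset.sum_comm

/-- **… WITH A REAL KERNEL**: `conj K_T = K_T` at `U ≡ 1` (`B5QGGQ145Bounds.conj_KT`), so `(Q̃′(G′(1)f))(y) = Σ_x (((c₀∕c₁)ρ)·K_T(x̂, ŷ))•f(x)`.
[cite: Balaban1985BackgroundPropagators, (3.25) p.394; Balaban1984PropagatorsI, (1.44) p.25] -/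
theorem equiv_QGp_one_apply_real (hη : η ≠ 0) {a' : ℝ} (ha' : 0 < a')
    (hpos' : ∀ x : SiteL2K ℂ (d + 1) (fineP L m) c₀ W, x ≠ 0 →
      0 < RCLike.re ⟪x, laplacePrimeA L m φ η (fun _ : Bond (d + 1) (fineP L m) => (1 : 𝔸ˣ)) a' (c₁ := c₁) x⟫_ℂ)
    (f : SiteL2K ℂ (d + 1) (fineP L m) c₀ W) (y : TSite (d + 1) m) :
    WL2.equiv ℂ _ W (((WL2.linearEquiv ℂ ℂ (fun _ : TSite (d + 1) m => c₁)).symm.toLinearMap ∘ₗ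
        QprimeW L m φ (fun _ : Bond (d + 1) (fineP L m) => (1 : 𝔸ˣ)) (c₀ := c₀))
        (GpOfU L m φ η (fun _ : Bond (d + 1) (fineP L m) => (1 : 𝔸ˣ)) a' (c₁ := c₁) hpos' f)) y =
      ∑ x : TSite (d + 1) (fineP L m), ((((c₀ / c₁ * ((η * L) ^ 2 * (c₁ / (c₀ * (L : ℝ) ^ (d + 1))))) : ℝ) : ℂ) *
        KT L (a' * (η * L) ^ 2 * (c₁ / (c₀ * (L : ℝ) ^ (d + 1)))) 0 m (liftSite x) (liftSite y)) • WL2.equiv ℂ _ W f x := by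
  have hc₀ : 0 < c₀ := Fact.out
  have hc₁ : 0 < c₁ := Fact.out
  have hL0 : (0 : ℝ) < L := by exact_mod_cast Nat.pos_of_ne_zero (NeZero.ne L)
  have hL1 : 1 ≤ L := Nat.one_le_iff_ne_zero.mpr (NeZero.ne L)
  have hA : 0 < a' * (η * L) ^ 2 * (c₁ / (c₀ * (L : ℝ) ^ (d + 1))) := by
    have : 0 < (η * L) ^ 2 := by positivity
    positivity
  rw [equiv_QGp_one_apply L m φ c₀ η c₁ hη ha' hpos' f y]
  refine Finset.sum_congr rfl fun x _ => ?_
  rw [conj_KT L hL1 _ 0 hA le_rfl (one_le_period m)]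

end Chain

/-! ## §3 Decay of the `B`-kernel in the chain's coarse torus metric -/

section Decay

variable (L : ℕ) [NeZero L] (m : Fin (d + 1) → ℕ) [∀ i, NeZero (m i)] [∀ i, NeZero (fineP L m i)]

/-- **THE `B`-KERNEL's DECAY**: b04's bound at `(L, a, 0, m)` gives `‖((c₀∕c₁)ρ)·conj K_T(x̂, ŷ)‖ ≤ (c₀∕c₁)ρ·MC·e^{−κ′·d_m(y, blk x)}` for `0 ≤ (c₀∕c₁)ρ` — the `hB`
shape of `block_decay_of_conv3_kernel`. [cite: Balaban1983RegularityDecay, Lemma 2.4 (2.35) p.582, (2.48) p.585; Balaban1985BackgroundPropagators, (3.49) p.399] -/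
theorem norm_flatB_le {a MC κ' σ : ℝ} (hκ' : 0 ≤ κ') (hσ : 0 ≤ σ)
    (hb : ∀ (τ : Fin (d + 1) → Fin L) (v : Fin (d + 1) → ℤ), ‖torusKernel248 L a 0 τ m v‖ ≤ MC * Real.exp (-(κ' * torusSupNorm m v)))
    (y : TSite (d + 1) m) (x : TSite (d + 1) (fineP L m)) :
    ‖((σ : ℝ) : ℂ) * conj (KT L a 0 m (liftSite x) (liftSite y))‖ ≤ σ * MC * Real.exp (-(κ' * tdist m y (blockCoord L m x))) := by
  have hm : ∀ i, 1 ≤ m i := one_le_period m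
  rw [norm_mul, Complex.norm_real, Real.norm_eq_abs, abs_of_nonneg hσ, Complex.norm_conj, tdist_symm hm, mul_assoc]
  exact mul_le_mul_of_nonneg_left (norm_KT_liftSite_le L m hκ' hb x y) hσ

end Decay

end Literature.MathematicalPhysics.QuantumFieldTheory.Balaban1983to89.B9Eq349FlatQGKernel

end
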